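import Summits.CriticalPhenomena.PercolationContinuityZ3.Theorems.FK.InfiniteVolumeDLRLocalLimitEnergy
import Summits.CriticalPhenomena.PercolationContinuityZ3.Theorems.FK.InfiniteVolumeDLROneEdgeIff
import Literature.Probability.Percolation.UniquenessInsertionTolerant
import Literature.Probability.Percolation.LocalEventsComparison
import HarnessLib

/-!
# FK-continuity transplant, FO-10 (infinite-volume structure): insertion tolerance from ONE-SIDED (lower) finite energy,
# and the lower half of the finite energy of local limits (Grimmett 2006, Thm. (4.33)(b), Prop. (4.37)(a), eq. (4.32))

Registered R103 (cell INBOX l.7022, 2026-08-24); registry row FO-10b-g412; label DRE-A (coordinator fk-4 g216).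
Cell `fk-continuity` (bschramm), FO-10b lineage; support file for the FK-continuity transplant
(`--supports stmt-CriticalPhenomena-4575`); builds on p205010 (kernel theorem, internal audit signed; external
expert review pending). CONDITIONAL cell (FH AND TP_FK open at the same `p` for `q > 1`; K1); the transplant is a
typed reduction, not a proof of FK continuity — this file is UNCONDITIONAL infinite-volume structure for general `d`;
no defs, no named facts, no sorries, standard axioms; NOT a binder discharge, NOT `_r4`; `_r3` « 2 / 0 ☑ »
unchanged, n_open = 2.

## What this file proves (Grimmett 2006, §4.4, pp. 81–82)

The model input of the Burton–Keane uniqueness argument (the tree's `IsInsertionTolerantErgodic`,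
`Literature.Probability.Percolation.UniquenessInsertionTolerant`; and its ergodicity-free form
`ae_numInfiniteClusters_le_one_of_shift_invariant`, `InfiniteVolumeDLRInvariantUniqueness.lean`) is INSERTION
TOLERANCE. This file derives it from the LOWER half of the one-edge finite-energy property alone, in the integrated
shape used throughout the FO-10b DLR files (`c · ν({ω ∖ e ∈ H₀}) ≤ ν({e open} ∩ {ω ∖ e ∈ H₀})` for all measurable
`H₀`, hypothesis `hE` of `InfiniteVolumeDLRDominationLower.lean`), and supplies that lower half for local limits
(Thm. (4.33)(b); `InfiniteVolumeDLRLocalLimitEnergy.lean` has the upper half) and for DLR measures (Prop. (4.37)(a)):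

* `mul_measureReal_preimage_openEdges_singleton_le_of_le_oneEdge`, **`pow_mul_measureReal_preimage_openEdges_le_of_le_oneEdge`**
  — lower one-edge finite energy with constant `c ≥ 0` at the lattice edges ⇒ INSERTION TOLERANCE
  `c^{|F|} · ν{ω | ω ∪ F ∈ S} ≤ ν(S)` for every finite set `F` of lattice edges and every measurable `S`
  (`{ω ∖ e ∈ H₀} = {ω ∪ e ∈ S}` for `H₀ = {ω ∪ e ∈ S}`, and `{e open} ∩ {ω ∪ e ∈ S} ⊆ S`; induction on `F`);
  `exists_pos_mul_measureReal_preimage_openEdges_box_le_of_le_oneEdge` — the box form (the `insertion_tolerant` field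
  of `IsInsertionTolerantErgodic`, hypothesis `hins` of `ae_numInfiniteClusters_le_one_of_shift_invariant`);
* `isInsertionTolerantErgodic_of_le_oneEdge` — with lattice support, translation invariance and ergodicity as
  hypotheses, the four Burton–Keane hypotheses of the tree (so `UniquenessConsequences.lean` applies);
* `le_measureReal_setOf_mem_inter_preimage_of_oneEdge` — the one-edge conditional probabilities (4.38) at `e` give the
  lower bound with `c = min(p, p/(p+q(1-p)))` (companion of `measureReal_setOf_mem_inter_preimage_le_of_oneEdge`,
  the upper bound with `max`); `min_energy_pos` (`c > 0` for `0 < p ≤ 1`, `q > 0`);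
* `le_measureReal_setOf_mem_inter_preimage_of_localLimit_of_isLocalEvent`,
  **`le_measureReal_setOf_mem_inter_preimage_of_forall_isLocalEvent`** — THM (4.33)(b), LOWER HALF: a local limit of
  finite measures eventually having (4.38) at `e` opens `e`, given the rest, with probability AT LEAST
  `min(p, p/(p+q(1-p)))` (limit on local events, then local → measurable by comparison of the finite measures
  `c · P∘(·∖e)⁻¹` and `P|_{e open}∘(·∖e)⁻¹` on the generating ring, `measure_le_of_forall_isLocalEvent_le`);
* `IsDLRRandomCluster.isInsertionTolerantErgodic_of_ergodic` — for EVERY `q > 0` and `0 < p ≤ 1`, a lattice-carried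
  translation-invariant ergodic `P ∈ R_{p,q}` satisfies `IsInsertionTolerantErgodic` (lower finite energy from
  Prop. (4.37)(a), `IsDLRRandomCluster.real_edgeOpen_inter_preimage_eq`; no FKG / sandwich input, so `q < 1` is
  covered — the tree had this for `q ≥ 1` only, `FKGibbs.isInsertionTolerantErgodic_of_isTailTrivial`).

The uniqueness conclusions themselves (Thm. (4.33)(c), Thm. (4.31) ∘ (4.33)) are drawn WITHOUT ergodicity in
`InfiniteVolumeDLRInvariantLimit.lean`.

## References

* G. Grimmett, *The Random-Cluster Model*, Springer 2006: Thm. (4.33)(b)(c) (p. 82), Prop. (4.37)(a) eq. (4.38)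
  (p. 82), Thm. (4.17)(b) / eq. (4.32) (finite energy), proof of Thm. (4.31) (pp. 83–86). [Grimmett2006]
* R. M. Burton, M. Keane, *Density and uniqueness in percolation*, Comm. Math. Phys. 121 (1989) 501–505. [BurtonKeane1989]
-/

noncomputable section

open MeasureTheory Filter Set

open scoped Topology ENNReal

namespace Summit.CriticalPhenomena.PercolationContinuityZ3.Theorems.FK

open Literature.Probability.Percolation Literature.Probability.LatticeModels

variable {d : ℕ}

/-! ### Lower one-edge finite energy ⇒ insertion tolerance -/

section InsertionTolerance

variable {ν : Measure (BondConfig (Site d))} {c : ℝ}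

/-- **One edge**: if `ν` opens `e`, given the rest, with probability at least `c`
(`c · ν({ω ∖ e ∈ H₀}) ≤ ν({e open} ∩ {ω ∖ e ∈ H₀})` for all measurable `H₀`), then `c · ν{ω | ω ∪ {e} ∈ S} ≤ ν(S)` for
every measurable `S` (take `H₀ = {ω | ω ∪ {e} ∈ S}`: then `{ω ∖ e ∈ H₀} = {ω ∪ {e} ∈ S}` and
`{e open} ∩ {ω ∖ e ∈ H₀} ⊆ S`). [cite: Grimmett2006, Thm. (4.17)(b), eq. (4.32); BurtonKeane1989, p. 502 (finite energy)] -/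
theorem mul_measureReal_preimage_openEdges_singleton_le_of_le_oneEdge [IsFiniteMeasure ν] {e : Sym2 (Site d)}
    (hE : ∀ ⦃H₀ : Set (BondConfig (Site d))⦄, MeasurableSet H₀ →
      c * ν.real ((fun η => η \ {e}) ⁻¹' H₀) ≤ ν.real ({ω | e ∈ ω} ∩ (fun η => η \ {e}) ⁻¹' H₀))
    {S : Set (BondConfig (Site d))} (hS : MeasurableSet S) :
    c * ν.real (openEdges {e} ⁻¹' S) ≤ ν.real S := by
  have hHm : MeasurableSet (openEdges {e} ⁻¹' S) := measurable_openEdges _ hS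
  have h1 : (fun η : BondConfig (Site d) => η \ {e}) ⁻¹' (openEdges {e} ⁻¹' S) = openEdges {e} ⁻¹' S := by
    ext ω
    simp only [Set.mem_preimage, openEdges, Set.sdiff_union_self]
  have h2 : {ω : BondConfig (Site d) | e ∈ ω} ∩ (fun η => η \ {e}) ⁻¹' (openEdges {e} ⁻¹' S) ⊆ S := by
    rintro ω ⟨he, hω⟩
    have he' : e ∈ ω := he
    simpa only [Set.mem_preimage, openEdges, Set.sdiff_union_self,
      Set.union_eq_self_of_subset_right (Set.singleton_subset_iff.2 he')] using hω
  calc c * ν.real (openEdges {e} ⁻¹' S)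
      = c * ν.real ((fun η : BondConfig (Site d) => η \ {e}) ⁻¹' (openEdges {e} ⁻¹' S)) := by rw [h1]
    _ ≤ ν.real ({ω | e ∈ ω} ∩ (fun η => η \ {e}) ⁻¹' (openEdges {e} ⁻¹' S)) := hE hHm
    _ ≤ ν.real S := measureReal_mono h2

/-- **Finitely many lattice edges**: lower one-edge finite energy with the constant `c ≥ 0` at every edge of `ℤ^d`
gives `c^{|F|} · ν{ω | ω ∪ F ∈ S} ≤ ν(S)` for every finite set `F` of lattice edges and every measurable `S`
(induction on `F`; the shape of `FKGibbs.pow_mul_real_preimage_openEdges_le`). [cite: Grimmett2006, Thm. (4.17)(b), eq. (4.32) and eq. (3.4)] -/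
theorem pow_mul_measureReal_preimage_openEdges_le_of_le_oneEdge [IsFiniteMeasure ν] (hc : 0 ≤ c)
    (hE : ∀ ⦃a b : Site d⦄, (zdGraph d).Adj a b → ∀ ⦃H₀ : Set (BondConfig (Site d))⦄, MeasurableSet H₀ →
      c * ν.real ((fun η => η \ {s(a, b)}) ⁻¹' H₀) ≤ ν.real ({ω | s(a, b) ∈ ω} ∩ (fun η => η \ {s(a, b)}) ⁻¹' H₀))
    {F : Finset (Sym2 (Site d))} (hF : (↑F : Set (Sym2 (Site d))) ⊆ (zdGraph d).edgeSet)
    {S : Set (BondConfig (Site d))} (hS : MeasurableSet S) :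
    c ^ F.card * ν.real (openEdges ↑F ⁻¹' S) ≤ ν.real S := by
  classical
  have hE' : ∀ {e : Sym2 (Site d)}, e ∈ (zdGraph d).edgeSet → ∀ ⦃S : Set (BondConfig (Site d))⦄, MeasurableSet S →
      c * ν.real (openEdges {e} ⁻¹' S) ≤ ν.real S := by
    intro e
    induction e using Sym2.ind with
    | _ a b =>
      intro he S hS
      exact mul_measureReal_preimage_openEdges_singleton_le_of_le_oneEdge (hE ((SimpleGraph.mem_edgeSet _).1 he)) hS
  induction F using Finset.induction_on generalizing S with
  | empty =>
    have h0 : openEdges (↑(∅ : Finset (Sym2 (Site d))) : Set (Sym2 (Site d))) ⁻¹' S = S := by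
      ext ω; simp [openEdges]
    rw [h0, Finset.card_empty, pow_zero, one_mul]
  | insert e F heF ih =>
    have hsplit : openEdges (↑(insert e F) : Set (Sym2 (Site d))) ⁻¹' S =
        openEdges {e} ⁻¹' (openEdges (↑F : Set (Sym2 (Site d))) ⁻¹' S) := by
      ext ω
      simp only [Set.mem_preimage, openEdges, Finset.coe_insert]
      rw [Set.insert_eq, Set.union_assoc]
    have heE : e ∈ (zdGraph d).edgeSet := hF (Finset.mem_coe.2 (Finset.mem_insert_self e F))
    have hFE' : (↑F : Set (Sym2 (Site d))) ⊆ (zdGraph d).edgeSet :=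
      fun f hf => hF (Finset.mem_coe.2 (Finset.mem_insert_of_mem (Finset.mem_coe.1 hf)))
    have h1 : c * ν.real (openEdges {e} ⁻¹' (openEdges (↑F : Set (Sym2 (Site d))) ⁻¹' S)) ≤
        ν.real (openEdges (↑F : Set (Sym2 (Site d))) ⁻¹' S) := hE' heE (measurable_openEdges _ hS)
    have h2 : c ^ F.card * ν.real (openEdges (↑F : Set (Sym2 (Site d))) ⁻¹' S) ≤ ν.real S := ih hFE' hS
    rw [hsplit, Finset.card_insert_of_notMem heF, pow_succ, mul_assoc]
    exact (mul_le_mul_of_nonneg_left h1 (pow_nonneg hc _)).trans h2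

/-- **Box form of insertion tolerance** (the `insertion_tolerant` field of the tree's `IsInsertionTolerantErgodic`):
lower one-edge finite energy with `c > 0` gives, for every box `Λ_N`, a constant `c' = c^{|E(Λ_N)|} > 0` with
`c' · ν{ω | ω ∪ E(Λ_N) ∈ S} ≤ ν(S)` for all measurable `S`. [cite: BurtonKeane1989, p. 502 (finite energy); Grimmett2006, eq. (4.32)] -/
theorem exists_pos_mul_measureReal_preimage_openEdges_box_le_of_le_oneEdge [IsFiniteMeasure ν] (hc : 0 < c)
    (hE : ∀ ⦃a b : Site d⦄, (zdGraph d).Adj a b → ∀ ⦃H₀ : Set (BondConfig (Site d))⦄, MeasurableSet H₀ →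
      c * ν.real ((fun η => η \ {s(a, b)}) ⁻¹' H₀) ≤ ν.real ({ω | s(a, b) ∈ ω} ∩ (fun η => η \ {s(a, b)}) ⁻¹' H₀))
    (N : ℕ) :
    ∃ c' : ℝ, 0 < c' ∧ ∀ {S : Set (BondConfig (Site d))}, MeasurableSet S →
      c' * ν.real (openEdges ↑(edgesIn (zdGraph d) (box d N)) ⁻¹' S) ≤ ν.real S :=
  ⟨c ^ (edgesIn (zdGraph d) (box d N)).card, pow_pos hc _, fun hS =>
    pow_mul_measureReal_preimage_openEdges_le_of_le_oneEdge hc.le hE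
      (fun _ he => (mem_edgesIn_iff.1 (Finset.mem_coe.1 he)).1) hS⟩

/-- **The four Burton–Keane hypotheses from lower one-edge finite energy**: a measure carried by lattice
configurations, invariant under the translations of `ℤ^d`, ergodic (translation-invariant events are trivial) and
opening every lattice edge, given the rest, with probability at least `c > 0` is `IsInsertionTolerantErgodic`.
[cite: BurtonKeane1989, Thm. 2 (stationary ergodic finite-energy measures); Grimmett2006, Thm. (4.33)(c) footnote 6] -/
theorem isInsertionTolerantErgodic_of_le_oneEdge [IsFiniteMeasure ν] (hlat : ∀ᵐ ω ∂ν, ω ⊆ (zdGraph d).edgeSet)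
    (hshift : ∀ (v : Site d) {S : Set (BondConfig (Site d))}, MeasurableSet S →
      ν (BondConfig.relabel (sym2Equiv (Site.shift v)) ⁻¹' S) = ν S)
    (hzo : ∀ {S : Set (BondConfig (Site d))}, MeasurableSet S →
      (∀ v : Site d, BondConfig.relabel (sym2Equiv (Site.shift v)) ⁻¹' S = S) → ν S = 0 ∨ ν S = 1)
    (hc : 0 < c)
    (hE : ∀ ⦃a b : Site d⦄, (zdGraph d).Adj a b → ∀ ⦃H₀ : Set (BondConfig (Site d))⦄, MeasurableSet H₀ →
      c * ν.real ((fun η => η \ {s(a, b)}) ⁻¹' H₀) ≤ ν.real ({ω | s(a, b) ∈ ω} ∩ (fun η => η \ {s(a, b)}) ⁻¹' H₀)) :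
    IsInsertionTolerantErgodic ν :=
  ⟨hlat, @fun v _ hS => hshift v hS, @fun _ hS hinv => hzo hS hinv,
    exists_pos_mul_measureReal_preimage_openEdges_box_le_of_le_oneEdge hc hE⟩

end InsertionTolerance

/-! ### The lower one-edge bound from the one-edge conditional probabilities (4.38), and for local limits -/

section Lower

variable {p q : ℝ} {P : Measure (BondConfig (Site d))} {μ : ℕ → Measure (BondConfig (Site d))} {x y : Site d}

/-- **One-edge identity ⇒ lower one-sided finite energy**: a finite measure with the one-edge conditional
probabilities (4.38) at `e = ⟨x,y⟩` opens `e`, given the rest, with probability at least `min(p, p/(p+q(1-p)))`.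
[cite: Grimmett2006, Prop. (4.37)(a) eq. (4.38), Thm. (4.17)(b) eq. (4.32)] -/
theorem le_measureReal_setOf_mem_inter_preimage_of_oneEdge (ν : Measure (BondConfig (Site d))) [IsFiniteMeasure ν]
    (hE : ∀ ⦃H₀ : Set (BondConfig (Site d))⦄, MeasurableSet H₀ →
      ν.real ({ω | s(x, y) ∈ ω} ∩ (fun η => η \ {s(x, y)}) ⁻¹' H₀) =
        p * ν.real ((fun η => η \ {s(x, y)}) ⁻¹' (H₀ ∩ openConn x y)) +
          p / (p + q * (1 - p)) * ν.real ((fun η => η \ {s(x, y)}) ⁻¹' (H₀ ∩ (openConn x y)ᶜ)))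
    {H₀ : Set (BondConfig (Site d))} (hH₀ : MeasurableSet H₀) :
    min p (p / (p + q * (1 - p))) * ν.real ((fun η => η \ {s(x, y)}) ⁻¹' H₀) ≤
      ν.real ({ω | s(x, y) ∈ ω} ∩ (fun η => η \ {s(x, y)}) ⁻¹' H₀) := by
  rw [hE hH₀, measureReal_preimage_sdiff_eq_add ν hH₀, mul_add]
  exact add_le_add (mul_le_mul_of_nonneg_right (min_le_left _ _) measureReal_nonneg)
    (mul_le_mul_of_nonneg_right (min_le_right _ _) measureReal_nonneg)

/-- **Finite energy of the local limit, lower half, on local events** (Grimmett 2006, Thm. (4.33)(b)): if the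
approximants eventually have the one-edge conditional probabilities at `e`, the local limit `P` opens `e`, given any
LOCAL outside information, with probability at least `min(p, p/(p+q(1-p)))`. [cite: Grimmett2006, Thm. (4.33)(b), proof of Thm. (4.31) p. 86] -/
theorem le_measureReal_setOf_mem_inter_preimage_of_localLimit_of_isLocalEvent [IsFiniteMeasure P]
    [∀ n, IsFiniteMeasure (μ n)]
    (hconv : ∀ A : Set (BondConfig (Site d)), IsLocalEvent A → Tendsto (fun n => μ n A) atTop (𝓝 (P A)))
    (hE : ∀ᶠ n in atTop, ∀ ⦃H₀ : Set (BondConfig (Site d))⦄, MeasurableSet H₀ →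
      (μ n).real ({ω | s(x, y) ∈ ω} ∩ (fun η => η \ {s(x, y)}) ⁻¹' H₀) =
        p * (μ n).real ((fun η => η \ {s(x, y)}) ⁻¹' (H₀ ∩ openConn x y)) +
          p / (p + q * (1 - p)) * (μ n).real ((fun η => η \ {s(x, y)}) ⁻¹' (H₀ ∩ (openConn x y)ᶜ)))
    {H₀ : Set (BondConfig (Site d))} (hH₀ : IsLocalEvent H₀) :
    min p (p / (p + q * (1 - p))) * P.real ((fun η => η \ {s(x, y)}) ⁻¹' H₀) ≤
      P.real ({ω | s(x, y) ∈ ω} ∩ (fun η => η \ {s(x, y)}) ⁻¹' H₀) := by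
  have hloc1 : IsLocalEvent ({ω : BondConfig (Site d) | s(x, y) ∈ ω} ∩ (fun η => η \ {s(x, y)}) ⁻¹' H₀) :=
    isLocalEvent_inter_preimage _ (isLocalEvent_setOf_mem _) hH₀
  have hloc2 : IsLocalEvent ((fun η : BondConfig (Site d) => η \ {s(x, y)}) ⁻¹' H₀) :=
    isLocalEvent_preimage_sdiff hH₀ _
  refine le_of_tendsto_of_tendsto ((tendsto_measureReal_of_tendsto_measure_isLocalEvent hconv hloc2).const_mul _)
    (tendsto_measureReal_of_tendsto_measure_isLocalEvent hconv hloc1) ?_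
  filter_upwards [hE] with n hn
  exact le_measureReal_setOf_mem_inter_preimage_of_oneEdge (μ n) hn (measurableSet_of_isLocalEvent_holds hH₀)

/-- **From local to measurable outside information, lower half**: if `c · P({ω ∖ e ∈ A}) ≤ P({e open} ∩ {ω ∖ e ∈ A})`
for every LOCAL `A` (`c ≥ 0`), then for every measurable `H₀` (comparison of the finite measures `c · P∘(·∖e)⁻¹` and
`(P|{e open})∘(·∖e)⁻¹`, which agree in order on the generating ring of local events:
`measure_le_of_forall_isLocalEvent_le`). [cite: Grimmett2006, Thm. (4.33)(b)] -/
theorem le_measureReal_setOf_mem_inter_preimage_of_forall_isLocalEvent [IsFiniteMeasure P] {c : ℝ} (hc : 0 ≤ c)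
    {e : Sym2 (Site d)}
    (h : ∀ ⦃A : Set (BondConfig (Site d))⦄, IsLocalEvent A →
      c * P.real ((fun η => η \ {e}) ⁻¹' A) ≤ P.real ({ω | e ∈ ω} ∩ (fun η => η \ {e}) ⁻¹' A))
    {H₀ : Set (BondConfig (Site d))} (hH₀ : MeasurableSet H₀) :
    c * P.real ((fun η => η \ {e}) ⁻¹' H₀) ≤ P.real ({ω | e ∈ ω} ∩ (fun η => η \ {e}) ⁻¹' H₀) := by
  set f : BondConfig (Site d) → BondConfig (Site d) := fun η => η \ {e} with hf
  have hfm : Measurable f := measurable_closeEdges _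
  have hJm : MeasurableSet {ω : BondConfig (Site d) | e ∈ ω} := measurableSet_mem e
  set ν₁ : Measure (BondConfig (Site d)) := ENNReal.ofReal c • P.map f with hν₁
  set ν₂ : Measure (BondConfig (Site d)) := (P.restrict {ω | e ∈ ω}).map f with hν₂
  haveI : IsFiniteMeasure (P.map f) := Measure.isFiniteMeasure_map P f
  haveI : IsFiniteMeasure ν₁ := by
    refine ⟨?_⟩
    rw [hν₁, Measure.smul_apply, smul_eq_mul]
    exact ENNReal.mul_lt_top ENNReal.ofReal_lt_top (measure_lt_top _ _)
  haveI : IsFiniteMeasure ν₂ := Measure.isFiniteMeasure_map _ f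
  have h1 : ∀ A : Set (BondConfig (Site d)), MeasurableSet A → ν₁ A = ENNReal.ofReal c * P (f ⁻¹' A) :=
    fun A hA => by rw [hν₁, Measure.smul_apply, smul_eq_mul, Measure.map_apply hfm hA]
  have h2 : ∀ A : Set (BondConfig (Site d)), MeasurableSet A → ν₂ A = P ({ω | e ∈ ω} ∩ f ⁻¹' A) :=
    fun A hA => by rw [hν₂, Measure.map_apply hfm hA, Measure.restrict_apply (hA.preimage hfm), Set.inter_comm]
  have hreal : ∀ A : Set (BondConfig (Site d)), MeasurableSet A →
      (c * P.real (f ⁻¹' A) ≤ P.real ({ω | e ∈ ω} ∩ f ⁻¹' A) ↔ ν₁ A ≤ ν₂ A) := fun A hA => by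
    rw [h1 A hA, h2 A hA,
      ← ENNReal.toReal_le_toReal (ENNReal.mul_ne_top ENNReal.ofReal_ne_top (measure_ne_top P (f ⁻¹' A)))
        (measure_ne_top P ({ω | e ∈ ω} ∩ f ⁻¹' A)),
      ENNReal.toReal_mul, ENNReal.toReal_ofReal hc, measureReal_def, measureReal_def]
  refine (hreal H₀ hH₀).2 (measure_le_of_forall_isLocalEvent_le (μ := ν₂) (ν := ν₁) (fun A hA => ?_) hH₀)
  exact (hreal A (measurableSet_of_isLocalEvent_holds hA)).1 (h hA)

/-- `0 < min(p, p/(p+q(1-p)))` for `0 < p ≤ 1`, `q > 0`. [folklore] -/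
theorem min_energy_pos (hp : p ∈ Set.Ioc (0 : ℝ) 1) (hq : 0 < q) : 0 < min p (p / (p + q * (1 - p))) :=
  lt_min hp.1 (div_pos hp.1 (by nlinarith [hp.1, hp.2, hq, mul_nonneg hq.le (sub_nonneg.2 hp.2)]))

end Lower

/-! ### Every translation-invariant ergodic DLR random-cluster measure has at most one infinite cluster (every `q > 0`) -/

section DLR

variable {p q : ℝ} {P : Measure (BondConfig (Site d))}

/-- **The Burton–Keane hypotheses for a translation-invariant ergodic member of `R_{p,q}`, every `q > 0`**
(`0 < p ≤ 1`): lattice support, translation invariance and ergodicity are the hypotheses; insertion tolerance comes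
from the lower half of Prop. (4.37)(a) (`P(J_e | 𝒯_e) ≥ min(p, p/(p+q(1-p))) > 0`). No FKG / sandwich input, so
`q < 1` is covered. [cite: Grimmett2006, Prop. (4.37)(a) eq. (4.38), Thm. (4.33)(c) footnote 6; BurtonKeane1989, Thm. 2] -/
theorem IsDLRRandomCluster.isInsertionTolerantErgodic_of_ergodic (hP : IsDLRRandomCluster d p q P)
    (hp : p ∈ Set.Ioc (0 : ℝ) 1) (hq : 0 < q) (hlat : ∀ᵐ ω ∂P, ω ⊆ (zdGraph d).edgeSet)
    (hshift : ∀ (v : Site d) {S : Set (BondConfig (Site d))}, MeasurableSet S →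
      P (BondConfig.relabel (sym2Equiv (Site.shift v)) ⁻¹' S) = P S)
    (hzo : ∀ {S : Set (BondConfig (Site d))}, MeasurableSet S →
      (∀ v : Site d, BondConfig.relabel (sym2Equiv (Site.shift v)) ⁻¹' S = S) → P S = 0 ∨ P S = 1) :
    IsInsertionTolerantErgodic P := by
  haveI := hP.isProbabilityMeasure
  exact isInsertionTolerantErgodic_of_le_oneEdge hlat hshift hzo (min_energy_pos hp hq) fun x y hxy H₀ hH₀ =>
    le_measureReal_setOf_mem_inter_preimage_of_oneEdge P
      (fun H hH => hP.real_edgeOpen_inter_preimage_eq ⟨hp.1.le, hp.2⟩ hq hxy hH) hH₀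

end DLR

end Summit.CriticalPhenomena.PercolationContinuityZ3.Theorems.FK

end
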